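import Summits.Ventures.LatticeQCDFlow.Scaling.LumpedStarStepChain

/-!
HONEST FRAMING: exact (Metropolis-corrected) sampling algorithms for lattice gauge theory; figures
of merit are autocorrelation/cost numbers at stated couplings and volumes; no continuum-physics
claim.

# LumpedStarStepCyclePowers — THE `j`-ATTEMPT CYCLE KERNELS OF THE LUMPED STAR'S STEP CHAIN: `AʲB(x,x') = Σ_a Kh(comp x)ʲ(hub x, a)·μ_0(hub x')·𝟙{comp x' + δ_a = comp x + δ_{hub x'}}`
# — THE CYCLE CHAIN OF CHAPTER W WITH THE END-HUB LAW REPLACED BY THE `j`-STEP HUB LAW (lean-2 GEN-43, ours)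

Venture-side (OURS).  Cell `lqcd-flow` (pub-lqcd), unit `pub-lqcd-lean-2-g43`, 2026-08-31.  Chapter AC, file 14 — the first lemma of the instantiation step of the C2 ∕ C4 assembly
(memo MEMO-gen43 §3 (g)).  Chapter X file 5 (`LumpedStarStepChain`) gave the step objects of the lumped star — `A(x,x') = 𝟙{comp x' = comp x}·Kh(comp x)(hub x, hub x')` (one swap
attempt moves only the hub), `B(x,x') = μ_0(hub x')𝟙{comp x' + δ_{hub x} = comp x + δ_{hub x'}}` (redraw of the hub particle) — and `UB = P` for the σ-resolvent `U`.  The clock-conditioned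
law (files 4–6) conditions on the attempt count: its cycle kernels are `C_0 = B`, `C_{j+1} = A·C_j`.  Here: **`C_j(x,x') = Σ_a w_j(comp x)(hub x, a)·μ_0(hub x')·𝟙{comp x' + δ_a = comp x +
δ_{hub x'}}`** with the `j`-step hub law `w_0(N)(h,·) = δ_h`, `w_{j+1}(N)(h,v) = Σ_g Kh(N)(h,g)·w_j(N)(g,v)` — i.e. chapter W's cycle kernel `P` (W19's `hP`, W file 2
`LumpedCycleAnyCoupling`'s `u`) with the end-hub law `u_x` replaced by `w_j(comp x)(hub x,·)`.  So `LumpedCycleAnyCoupling` applies to every `C_j` verbatim (its `u : X → S → ℝ` is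
arbitrary), which is how the per-attempt bracket (file 10) meets the interface (file 6).

* `starStep_swap_fiber` (one swap step of a hub-law kernel is the hub-law kernel of the evolved law), **`starStep_cyclePow_eq`**.

The backward recursion of `w_j` is the one `C_{j+1} = A·C_j` produces; it agrees with the forward recursion of the tagged laws (`x_{j+1} = x_jKh`) by `clock_pow_comm` (C1).
Literature grade (cell rule): OWN, plumbing; nothing cited; no new bib keys.
-/

open Finset

namespace Summit.Ventures.LatticeQCDFlow.Scaling

section StepCyclePowers
variable {X : Type*} [Fintype X] {S : Type*} [Fintype S] [DecidableEq S]
variable {hub : X → S} {comp : X → S → ℕ} {K : ℕ} {μ0 W : S → ℝ} {acc : S → S → ℝ} {Kh : (S → ℕ) → S → S → ℝ}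
variable {Ast Bst : X → X → ℝ} {C : ℕ → X → X → ℝ} {w : ℕ → (S → ℕ) → S → S → ℝ}

/-- **One swap step in front of a hub-law kernel:** for any `φ : S → S → ℝ` (a quantity depending on a state only through its hub content, at fixed composition),
`Σ_z A(x,z)·𝟙{comp z = comp x}φ(hub z) = Σ_h Kh(comp x)(hub x, h)·φ(h)` — absent contents contribute nothing. [ours] -/
theorem starStep_swap_fiber (hinj : ∀ x x', hub x = hub x' → comp x = comp x' → x = x')
    (hsurj : ∀ (z : S) (N : S → ℕ), ∑ v, N v = K + 1 → N z ≠ 0 → ∃ x, hub x = z ∧ comp x = N) (hhub : ∀ x, comp x (hub x) ≠ 0)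
    (hsum : ∀ x, ∑ v, comp x v = K + 1)
    (hKoff : ∀ N h v, h ≠ v → Kh N h v = if N h = 0 then 0 else (N v : ℝ) / K * acc h v)
    (hA : ∀ x x', Ast x x' = if comp x' = comp x then Kh (comp x) (hub x) (hub x') else 0)
    (x : X) (φ : S → ℝ) :
    ∑ z, Ast x z * (if comp z = comp x then φ (hub z) else 0) = ∑ h, Kh (comp x) (hub x) h * φ h := by
  classical
  have e : ∀ z, Ast x z * (if comp z = comp x then φ (hub z) else 0) = if comp z = comp x then Kh (comp x) (hub x) (hub z) * φ (hub z) else 0 := by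
    intro z
    by_cases h1 : comp z = comp x
    · rw [hA]; simp only [if_pos h1]
    · rw [if_neg h1, mul_zero, if_neg h1]
  rw [sum_congr rfl fun z _ => e z, star_sum_fiber hinj hsurj hhub (comp x) (hsum x) (fun h => Kh (comp x) (hub x) h * φ h)]
  refine sum_congr rfl fun h _ => ?_
  by_cases hh : comp x h = 0
  · rw [if_pos hh]
    have hne : hub x ≠ h := fun e => hhub x (e ▸ hh)
    rw [hKoff (comp x) (hub x) h hne, if_neg (hhub x), hh]
    simp
  · rw [if_neg hh]

/-- **THE `j`-ATTEMPT CYCLE KERNELS:** `C_j(x,x') = Σ_a w_j(comp x)(hub x, a)·μ_0(hub x')·𝟙{comp x' + δ_a = comp x + δ_{hub x'}}` for `C_0 = B`, `C_{j+1} = A·C_j`,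
`w_0(N)(h,·) = δ_h`, `w_{j+1}(N)(h,v) = Σ_g Kh(N)(h,g)w_j(N)(g,v)`. [ours] -/
theorem starStep_cyclePow_eq (hinj : ∀ x x', hub x = hub x' → comp x = comp x' → x = x')
    (hsurj : ∀ (z : S) (N : S → ℕ), ∑ v, N v = K + 1 → N z ≠ 0 → ∃ x, hub x = z ∧ comp x = N) (hhub : ∀ x, comp x (hub x) ≠ 0)
    (hsum : ∀ x, ∑ v, comp x v = K + 1)
    (hKoff : ∀ N h v, h ≠ v → Kh N h v = if N h = 0 then 0 else (N v : ℝ) / K * acc h v)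
    (hA : ∀ x x', Ast x x' = if comp x' = comp x then Kh (comp x) (hub x) (hub x') else 0)
    (hB : ∀ x x', Bst x x' = μ0 (hub x') * (if comp x' + Pi.single (hub x) 1 = comp x + Pi.single (hub x') 1 then 1 else 0))
    (hC0 : ∀ x x', C 0 x x' = Bst x x') (hCs : ∀ j x x', C (j + 1) x x' = ∑ z, Ast x z * C j z x')
    (hw0 : ∀ N h v, w 0 N h v = if v = h then 1 else 0) (hws : ∀ j N h v, w (j + 1) N h v = ∑ g, Kh N h g * w j N g v) :
    ∀ j x x', C j x x' = ∑ a, w j (comp x) (hub x) a * (μ0 (hub x') * (if comp x' + Pi.single a 1 = comp x + Pi.single (hub x') 1 then (1 : ℝ) else 0)) := by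
  classical
  intro j
  induction j with
  | zero =>
      intro x x'
      rw [hC0, hB]
      simp_rw [hw0]
      rw [show (∑ a, (if a = hub x then (1:ℝ) else 0) * (μ0 (hub x') * (if comp x' + Pi.single a 1 = comp x + Pi.single (hub x') 1 then (1 : ℝ) else 0)))
          = ∑ a, (if a = hub x then μ0 (hub x') * (if comp x' + Pi.single a 1 = comp x + Pi.single (hub x') 1 then (1 : ℝ) else 0) else 0) from
        sum_congr rfl fun a _ => by split_ifs <;> simp]
      rw [sum_ite_eq' univ (hub x), if_pos (mem_univ _)]
  | succ j ih =>
      intro x x'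
      rw [hCs]
      -- `C_j(z,x')` depends on `z` only through `(comp z, hub z)`; restrict to the fibre `comp z = comp x`
      have e : ∀ z, Ast x z * C j z x'
          = Ast x z * (if comp z = comp x then
              ∑ a, w j (comp x) (hub z) a * (μ0 (hub x') * (if comp x' + Pi.single a 1 = comp x + Pi.single (hub x') 1 then (1 : ℝ) else 0)) else 0) := by
        intro z
        by_cases h1 : comp z = comp x
        · rw [if_pos h1, ih z x', h1]
        · rw [hA, if_neg h1, zero_mul, zero_mul]
      have hsw := starStep_swap_fiber hinj hsurj hhub hsum hKoff hA x
        (fun h => ∑ a, w j (comp x) h a * (μ0 (hub x') * (if comp x' + Pi.single a 1 = comp x + Pi.single (hub x') 1 then (1 : ℝ) else 0)))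
      beta_reduce at hsw
      rw [sum_congr rfl fun z _ => e z, hsw]
      -- exchange the sums: `Σ_h Kh(h₀,h) Σ_a w_j(h,a)(…) = Σ_a (Σ_h Kh(h₀,h)w_j(h,a))(…) = Σ_a w_{j+1}(h₀,a)(…)`
      simp_rw [hws, mul_sum, sum_mul]
      rw [sum_comm]
      exact sum_congr rfl fun a _ => sum_congr rfl fun h _ => by ring

end StepCyclePowers

end Summit.Ventures.LatticeQCDFlow.Scaling
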